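import Mathlib
import HarnessLib
import Summits.ResolutionOfSingularities.ResolutionOfSingularities.Theorems.WildQuotientsWildQuotientResolutionBlowupExitBasicOpenSections
import Summits.ResolutionOfSingularities.ResolutionOfSingularities.Theorems.WildQuotientsWildQuotientResolutionPrincipalChartRees
import Summits.ResolutionOfSingularities.ResolutionOfSingularities.Theorems.WildQuotientsWildQuotientResolutionJordanThreeTwoFrame

/-!
# N4a (`𝔸ⁿ/(J₃ ⊕ J₂)`): the seam at the cone chart `O_a = V[x_a]` of `V = Bl_I 𝔸ⁿ`,
# `I = (x_a, x_b², x_b x_d, x_d²)` (for the cone column `HPa`)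
(crux stmt-ResolutionOfSingularities-15640 `WildQuotients.WildQuotientResolution`, line `Sketch`;
chain w45c post-V5 width target N4a `JordanThreeTwo.jordanThreeTwo_hasResolution`
(res-L1-w45c-stub-2 SIG 2026-08-27T14:24:14Z; res-L1-w45c-stub-2 ANSWERS 15:49:45Z (1) «ONE seam only,
for the CONE chart O_a := V[x_a]»; res-L1-w45c-plan-1 RULING N4a DIVISION OF RECORD 15:49:57Z
«033 := …JordanThreeTwoChartASeam.lean»); frame = res-L1-w45c-stub-2's `…JordanThreeTwoFrame`
(p544068: `smul_I4_pointwise`, `smul_X_a_eq`, abstract `hJ`); written by res-D-pv-033;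
[OURS · L1 W4.5c] — the N4a instantiation of `BlowupExit.exists_basicOpen_sectionsEquiv` (p510259)
in the mould of `ToricExit.exists_sectionsEquiv_chartA` (V3, `I₂ = (x_a, x_b²)`) and
`JordanFive.exists_sectionsEquiv_chart0_appLE` (V5, p536366); assembly of landed decls, NOT a statement
of any manuscript.)

Letters of the N4a SIG: `σ x_b = x_b + x_a`, `σ x_c = x_c + x_b`, `σ x_e = x_e + x_d`, passengers
`i ∉ {b, c, e}` fixed; `I = Ideal.span (Set.range ![X a, X b ^ 2, X b * X d, X d ^ 2])` (centre spelling
of record); `ι₀ = (ΓSpecIso k[x]).inv`; `q : 𝔸ⁿ → 𝔸ⁿ/⟨σ⟩`; `ρB` an `ActionOver (affineBlowup.π I ≫ q)`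
with `ρB.aut = liftAction ρ hJ` for an ABSTRACT `hJ`; `Oa : ρB.StableAffineOpens` with
`Oa.1 = V[x_a] := blowupChart (affineBlowup.π I) (affineBlowup.idealSheaf I) ⟨⊤,_⟩ (ι₀ (X a))` (stub-2's
`Vch 0`, `ι₀ (![…] 0) = ι₀ (X a)` by `rfl`).

* `JordanThreeTwo.X_a_mem_I4`, `gens_mem_I4` — `x_a ∈ I`, `gens j ∈ I`;
* `JordanThreeTwo.exists_reesGradedHom_family_I4` — the coefficientwise Rees automorphisms `φ g`
  (`g⁻¹` on coefficients) of `k[x][I t]`, `g ∈ ⟨σ⟩`, with the `Proj.map` hypothesis and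
  `φ g (x_a t) = x_a t`;
* **`JordanThreeTwo.exists_sectionsEquiv_chart_a_appLE` — THE SEAM at `V[x_a]`**: `φ`, `hP`, and
  `Ωₐ : (k[x][I t])_{(x_a t)} ≃+* Γ(↥Oa.1, (Oa.1.ι ≫ π ≫ q)⁻¹ ⊤)` with (o) the coefficient law,
  (i′) `(Oa.ι)^*((π^* f)|_{V[x_a]}) = Ωₐ (f/1)` in the ring-brick `appLE` spelling
  (`f/1 = reesChartBase x_a f = (fromZeroRingHom ∘ zeroRingHom) f`, by `rfl`), (ii) the action law
  `act g (Ωₐ y) = Ωₐ (map (φ g⁻¹) y)`, (iii) `Ωₐ y ∈ invariantsRing ⊤ ↔ ∀ g, map (φ g) y = y` — so the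
  cone brick `HPa` reduces to algebra inside `(k[x][I t])_{(x_a t)}` (`ψ := Ωₐ ∘ ψC`,
  `BlowupExit.ringBrick_transport₂` / `JordanFour.ringBrick_transport`, E-engine
  `BlowupExit.map_away_fixed_iff_of_intertwines`);
* `JordanThreeTwo.awayMk_gens_mul_base` — the three CHART RATIOS `(gens j · t)/(x_a t)`
  (`x_b²/x_a`, `x_b x_d/x_a`, `x_d²/x_a`; and `1` for `j = 0`) satisfy `ratio_j · (x_a/1) = gens j/1`
  in `(k[x][I t])_{(x_a t)}` — the ring-side `ht` of a cone brick; `exists_pow_mul_eq_base_chart_a` —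
  every element of the chart ring is `r/1` after multiplication by a power of `x_a/1`;
  `reesChartBase_X_a_mem_nonZeroDivisors` — `x_a/1` is a nonzerodivisor there (Stacks 0804; so `ht` pins the ratios).
-/

-- single-problem summit: the doubled namespace component `ResolutionOfSingularities` is forced
set_option linter.dupNamespace false

noncomputable section

open CategoryTheory AlgebraicGeometry TopologicalSpace MvPolynomial Polynomial HomogeneousLocalization
open Literature.AlgebraicGeometry.Resolution Literature.AlgebraicGeometry.RelativeSpec
open scoped Pointwise

namespace Summit.ResolutionOfSingularities.ResolutionOfSingularities.Theorems.WildQuotientResolution.JordanThreeTwo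

variable (k : Type) [Field k] (n : ℕ) (σ : MvPolynomial (Fin n) k ≃ₐ[k] MvPolynomial (Fin n) k)
  (a b c d e : Fin n) (hab : a ≠ b) (hac : a ≠ c) (hae : a ≠ e) (hbd : b ≠ d) (hcd : c ≠ d)
  (hde : d ≠ e) (hb : σ (X b) = X b + X a) (hσ : ∀ i, i ≠ b → i ≠ c → i ≠ e → σ (X i) = X i)

/-- the generator vector of `I` (local shorthand; unfolds at elaboration) -/
local notation3 "g4" => (![X a, X b ^ 2, X b * X d, X d ^ 2] : Fin 4 → MvPolynomial (Fin n) k)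
/-- `I = (x_a, x_b², x_b x_d, x_d²)` (local shorthand) -/
local notation3 "I4" => Ideal.span (Set.range g4)
/-- `ι₀ : k[x] → Γ(Spec k[x], ⊤)` (local shorthand) -/
local notation3 "ι₀" => (Scheme.ΓSpecIso (CommRingCat.of (MvPolynomial (Fin n) k))).inv.hom
/-- the quotient map `q : 𝔸ⁿ → 𝔸ⁿ/⟨σ⟩` (local shorthand) -/
local notation3 "qσ" => Spec.map (CommRingCat.ofHom (algebraMap
  (FixedPoints.subalgebra k (MvPolynomial (Fin n) k) (Subgroup.zpowers σ)) (MvPolynomial (Fin n) k)))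

/-- `x_a ∈ I` (generator `0`). [folklore] -/
theorem X_a_mem_I4 : (X a : MvPolynomial (Fin n) k) ∈ I4 :=
  Ideal.subset_span ⟨0, rfl⟩

/-- `gens j ∈ I`. [folklore] -/
theorem gens_mem_I4 (j : Fin 4) : g4 j ∈ I4 :=
  Ideal.subset_span ⟨j, rfl⟩

include hab hac hae hbd hcd hde hb hσ in
/-- **The `φ`-family for `I = (x_a, x_b², x_b x_d, x_d²)`**: coefficientwise `g⁻¹` graded automorphisms
of `k[x][I t]`, `g ∈ ⟨σ⟩` (from `JordanThreeTwo.smul_I4_pointwise`, res-L1-w45c-stub-2), with the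
`Proj.map` hypothesis, fixing the chart section `x_a t` (`g • x_a = x_a`, `JordanThreeTwo.smul_X_a_eq`).
[OURS · L1 W4.5c] [folklore; assembly of landed decls] -/
theorem exists_reesGradedHom_family_I4 :
    ∃ φ : ↥(Subgroup.zpowers σ) → (reesGrading I4 →+*ᵍ reesGrading I4),
      (∀ (g : ↥(Subgroup.zpowers σ)) x, ((φ g x : reesAlgebra I4) : (MvPolynomial (Fin n) k)[X]) =
        (x : (MvPolynomial (Fin n) k)[X]).map ((MulSemiringAction.toRingEquiv (↥(Subgroup.zpowers σ))
          (MvPolynomial (Fin n) k) g⁻¹ : _ ≃+* _) : _ →+* _)) ∧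
      (∀ g, HomogeneousIdeal.irrelevant (reesGrading I4) ≤
        (HomogeneousIdeal.irrelevant (reesGrading I4)).map (φ g)) ∧
      (∀ g, φ g (reesT (X a : MvPolynomial (Fin n) k) (X_a_mem_I4 k n a b d)) =
        reesT (X a : MvPolynomial (Fin n) k) (X_a_mem_I4 k n a b d)) := by
  have H := BlowupExit.exists_reesGradedHom_family (I := I4)
    (smul_I4_pointwise k n σ a b c d e hab hac hae hbd hcd hde hb hσ)
  rcases H with ⟨φ, hφ, hf⟩
  refine ⟨φ, hφ, hf, fun g => ?_⟩
  refine BlowupExit.reesGradedHom_eq_self_of_monomial _ (X a) (coe_reesT _ _) (φ g) _ (hφ g) ?_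
  change (MulSemiringAction.toRingEquiv _ _ g⁻¹) (X a) = X a
  rw [MulSemiringAction.toRingEquiv_apply_apply]
  exact smul_X_a_eq k n σ a b c e hab hac hae hσ g⁻¹

include hab hac hae hbd hcd hde hb hσ in
-- the statement is long (literal binder types of the scaffold); elaboration and the `CoeFun`
-- synthesis for `Ω` on the literal sections type need head-room
set_option maxHeartbeats 4000000 in
set_option synthInstance.maxHeartbeats 400000 in
/-- **The seam at `O_a = V[x_a]` (for the cone column `HPa` of N4a), ring-brick `appLE` spelling.**
For the binders `(ρ hρ hJ ρB haut Oa hOa hle)` (abstract `hJ`; `Oa.1 = V[x_a]`): the `φ`-family, `hP`,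
and `Ωₐ : (k[x][I t])_{(x_a t)} ≃+* Γ(↥Oa.1, (Oa.1.ι ≫ π ≫ q)⁻¹ ⊤)` with (o) the coefficient law,
(i′) `(Oa.ι)^*((π^* f)|_{V[x_a]}) = Ωₐ (reesChartBase x_a f)` (`= Ωₐ (f/1)`), (ii) the action law,
(iii) invariants `↔` fixed by all `HomogeneousLocalization.map (φ g)`.
[OURS · L1 W4.5c] [folklore; assembly of landed decls] -/
theorem exists_sectionsEquiv_chart_a_appLE
    (ρ : ↥(Subgroup.zpowers σ) →* Aut (Spec (CommRingCat.of (MvPolynomial (Fin n) k))))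
    (hρ : ∀ g : ↥(Subgroup.zpowers σ), (ρ g).hom = Spec.map (CommRingCat.ofHom
      ((MulSemiringAction.toRingEquiv (↥(Subgroup.zpowers σ)) (MvPolynomial (Fin n) k) g⁻¹ :
        MvPolynomial (Fin n) k ≃+* MvPolynomial (Fin n) k) :
          MvPolynomial (Fin n) k →+* MvPolynomial (Fin n) k)))
    (hJ : ∀ g : ↥(Subgroup.zpowers σ),
      (affineBlowup.idealSheaf I4).comap (ρ g).hom = affineBlowup.idealSheaf I4)
    (ρB : ActionOver (affineBlowup.π I4 ≫ qσ) ↥(Subgroup.zpowers σ))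
    (haut : ρB.aut = (affineBlowup.isBlowup I4).liftAction ρ hJ)
    (Oa : ρB.StableAffineOpens)
    (hOa : Oa.1 = blowupChart (affineBlowup.π I4) (affineBlowup.idealSheaf I4)
      ⟨⊤, isAffineOpen_top _⟩ (ι₀ (X a)))
    (hle : ((Oa.1.ι ≫ affineBlowup.π I4 ≫ qσ) ⁻¹ᵁ ⊤ : (Oa.1 : Scheme.{0}).Opens) ≤
      Oa.1.ι ⁻¹ᵁ blowupChart (affineBlowup.π I4) (affineBlowup.idealSheaf I4)
        ⟨⊤, isAffineOpen_top _⟩ (ι₀ (X a))) :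
    ∃ (φ : ↥(Subgroup.zpowers σ) → (reesGrading I4 →+*ᵍ reesGrading I4))
      (hP : ∀ g, Submonoid.powers (reesT (X a : MvPolynomial (Fin n) k) (X_a_mem_I4 k n a b d)) ≤
        (Submonoid.powers (reesT (X a : MvPolynomial (Fin n) k) (X_a_mem_I4 k n a b d))).comap
          (φ g))
      (Ω : HomogeneousLocalization.Away (reesGrading I4)
          (reesT (X a : MvPolynomial (Fin n) k) (X_a_mem_I4 k n a b d)) ≃+*
        Γ((Oa.1 : Scheme.{0}), (Oa.1.ι ≫ affineBlowup.π I4 ≫ qσ) ⁻¹ᵁ ⊤)),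
      (∀ (g : ↥(Subgroup.zpowers σ)) x, ((φ g x : reesAlgebra I4) : (MvPolynomial (Fin n) k)[X]) =
        (x : (MvPolynomial (Fin n) k)[X]).map ((MulSemiringAction.toRingEquiv
          (↥(Subgroup.zpowers σ)) (MvPolynomial (Fin n) k) g⁻¹ : _ ≃+* _) : _ →+* _)) ∧
      (∀ f : MvPolynomial (Fin n) k,
        Oa.1.ι.appLE (blowupChart (affineBlowup.π I4) (affineBlowup.idealSheaf I4)
            ⟨⊤, isAffineOpen_top _⟩ (ι₀ (X a)))
          ((Oa.1.ι ≫ affineBlowup.π I4 ≫ qσ) ⁻¹ᵁ ⊤) hle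
          ((affineBlowup.π I4).appLE ⊤ (blowupChart (affineBlowup.π I4) (affineBlowup.idealSheaf I4)
            ⟨⊤, isAffineOpen_top _⟩ (ι₀ (X a))) (blowupChart_le_preimage _ _ _ _) (ι₀ f)) =
        Ω (reesChartBase (X a : MvPolynomial (Fin n) k) (X_a_mem_I4 k n a b d) f)) ∧
      (∀ (g : ↥(Subgroup.zpowers σ)) y, (ρB.restrict Oa.1 Oa.2.1).act g ⊤ (Ω y) =
        Ω (HomogeneousLocalization.map (φ g⁻¹) (hP g⁻¹) y)) ∧
      (∀ y, Ω y ∈ (ρB.restrict Oa.1 Oa.2.1).invariantsRing ⊤ ↔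
        ∀ g, HomogeneousLocalization.map (φ g) (hP g) y = y) := by
  have H := exists_reesGradedHom_family_I4 k n σ a b c d e hab hac hae hbd hcd hde hb hσ
  rcases H with ⟨φ, hφ, hf, hφa⟩
  have h0 := X_a_mem_I4 k n a b d
  have hP : ∀ g, Submonoid.powers (reesT (X a : MvPolynomial (Fin n) k) h0) ≤
      (Submonoid.powers (reesT (X a : MvPolynomial (Fin n) k) h0)).comap (φ g) := by
    intro g
    rintro _ ⟨m, rfl⟩
    exact ⟨m, by change _ ^ m = φ g (_ ^ m); rw [map_pow, hφa g]⟩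
  have hOs : Oa.1 = Proj.basicOpen (reesGrading I4) (reesT (X a : MvPolynomial (Fin n) k) h0) :=
    hOa.trans (ToricExit.blowupChart_affineBlowup_eq_basicOpen_reesT (X a) h0)
  have H2 := BlowupExit.exists_basicOpen_sectionsEquiv ρ hρ hJ qσ ρB (fun g => by rw [haut])
    (reesT (X a : MvPolynomial (Fin n) k) h0) (reesT_mem _ _) one_pos φ hφ hf hφa hP
    Oa.1 Oa.2.1 hOs
  rcases H2 with ⟨Ω, hΩi, hΩii⟩
  refine ⟨φ, hP, Ω, hφ, fun f => ?_, hΩii, fun y => ?_⟩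
  · -- (i') from (i) by composing the two `appLE`s
    rw [← CommRingCat.comp_apply, Scheme.Hom.appLE_comp_appLE]
    exact (hΩi f).symm
  · exact BlowupExit.mem_invariantsRing_iff_of_sectionsEquiv qσ ρB _ φ hP Oa.1 Oa.2.1 Ω hΩii y

/-- **The chart ratios.** In `(k[x][I t])_{(x_a t)}` the degree-`0` fraction `(gens j · t)/(x_a t)`
(`j = 1, 2, 3`: `x_b²/x_a`, `x_b x_d/x_a`, `x_d²/x_a`; `j = 0`: `1`) times `x_a/1` is `gens j/1` — the
ring-side `ht` of a cone brick (`base (X a) * t j = base (gens j)` up to `mul_comm`). [folklore] -/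
theorem awayMk_gens_mul_base (j : Fin 4) :
    HomogeneousLocalization.Away.mk (reesGrading I4) (reesT_mem (X a : MvPolynomial (Fin n) k)
        (X_a_mem_I4 k n a b d)) 1 (reesT (g4 j) (gens_mem_I4 k n a b d j))
        (by simpa only [smul_eq_mul, mul_one] using reesT_mem (g4 j) (gens_mem_I4 k n a b d j)) *
      reesChartBase (X a : MvPolynomial (Fin n) k) (X_a_mem_I4 k n a b d) (X a) =
    reesChartBase (X a : MvPolynomial (Fin n) k) (X_a_mem_I4 k n a b d) (g4 j) := by
  have h := BlowupExit.awayMk_mul_base_pow (reesT (X a : MvPolynomial (Fin n) k) (X_a_mem_I4 k n a b d))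
    (reesT_mem _ _) (X a) (coe_reesT _ _) 1 (reesT (g4 j) (gens_mem_I4 k n a b d j))
    (by simpa only [smul_eq_mul, mul_one] using reesT_mem (g4 j) (gens_mem_I4 k n a b d j)) (g4 j)
    (by rw [one_mul]; exact coe_reesT _ _)
  -- `pow_one` through the `HomogeneousLocalization` power instance
  have e : ∀ z : HomogeneousLocalization.Away (reesGrading I4)
      (reesT (X a : MvPolynomial (Fin n) k) (X_a_mem_I4 k n a b d)), z ^ 1 = z := fun z => pow_one z
  rw [e] at h
  exact h

/-- **Every element of the chart ring `(k[x][I t])_{(x_a t)}` becomes `r/1` after multiplication by a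
power of `x_a/1`** (it is generated over `k[x]/1` by the three ratios). [folklore] -/
theorem exists_pow_mul_eq_base_chart_a
    (y : HomogeneousLocalization.Away (reesGrading I4)
      (reesT (X a : MvPolynomial (Fin n) k) (X_a_mem_I4 k n a b d))) :
    ∃ (m : ℕ) (r : MvPolynomial (Fin n) k),
      y * reesChartBase (X a : MvPolynomial (Fin n) k) (X_a_mem_I4 k n a b d) (X a) ^ m =
        reesChartBase (X a : MvPolynomial (Fin n) k) (X_a_mem_I4 k n a b d) r :=
  BlowupExit.exists_pow_mul_eq_base _ (reesT_mem _ _) (X a) (coe_reesT _ _) y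

/-- **`x_a/1` is a nonzerodivisor in `(k[x][I t])_{(x_a t)}`** (Stacks 0804: the image of `a` in
`R[I/a]` is regular), so the ratios are DETERMINED by `ratio_j · (x_a/1) = gens j/1`.
[cite: StacksProject, Tag 0804] -/
theorem reesChartBase_X_a_mem_nonZeroDivisors :
    reesChartBase (X a : MvPolynomial (Fin n) k) (X_a_mem_I4 k n a b d) (X a) ∈
      nonZeroDivisors (HomogeneousLocalization.Away (reesGrading I4)
        (reesT (X a : MvPolynomial (Fin n) k) (X_a_mem_I4 k n a b d))) :=
  reesChartBase_mem_nonZeroDivisors (X a) (X_a_mem_I4 k n a b d)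

end Summit.ResolutionOfSingularities.ResolutionOfSingularities.Theorems.WildQuotientResolution.JordanThreeTwo

end
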